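import Literature.MathematicalPhysics.QuantumFieldTheory.BalabanImbrieJaffe1984to88.BIJ88RandomWalk242
import Literature.MathematicalPhysics.QuantumFieldTheory.BalabanImbrieJaffe1984to88.BIJ88WalkGeometry246

/-!
# `BalabanImbrieJaffe1984to88.BIJ88Ineq246Walks` — T. Bałaban, J. Imbrie, A. Jaffe, *Effective action and cluster
properties of the abelian Higgs model*, Commun. Math. Phys. **114** (1988) 257–315 [BalabanImbrieJaffe1988]:
Sect. 2 p. 264, **(2.46)** `|C^{(k)}_{Λ,X}(u; x₁, x₂)| ≦ e^{−cr(e_k)|X|}` PROVED in the setting of [6] =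
[Balaban1983RegularityDecay] for the `C^{(k)}_{Λ,X}` of `BIJ88RandomWalk242.cX` (seat p13, rows C2.Eq2.42–2.45), and the
typed row `BIJ88Sect2Statements.Ineq246` assembled («model instance»).

statement-level skeleton of published theorems with citation tags; proofs where landed; nothing here is a claim about the Yang–Mills mass gap

PDF held: `paper:balaban1988-cmp114-bij-abelian-higgs-effective-action` (journal page = PDF page + 256).  Page read as an
image (poppler ×3 crops of PDF pp. 8–9 = journal 264–265).

TEXT UNDER FORMALIZATION (p. 264, verbatim): *"and the convergence and locality properties of the random walk expansion
imply the following facts about these operators. … The operator C^{(k)}_{Λ,X}(u) depends only on u in X. It vanishes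
unless both arguments are in X, and is estimated as follows: |C^{(k)}_{Λ,X}(u; x₁, x₂)| ≦ e^{−cr(e_k)|X|}. (2.46)"*;
p. 265: *"Here and elsewhere, |X| refers to the number of r(e_k)-cubes in X, not the volume of X."*

CITATION HEADER (lean-in-tree rule).  Part of the lit-balaban TYPED SKELETON (HOME `run/shared/lean/pub/lit-balaban/`),
Phase 2, seat p36 (gen 2, unit `lit-balaban-p36`); row **C2.Eq2.46** (`BIJ88Sect2Statements.Ineq246`, typed by r18
p239939): its first conjunct (support) is seat p13's `BIJ88RandomWalk242.cX_support`, its second conjunct (the bound) is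
PROVED here, and p13's knitting lemma `ineq246_of_bound` yields the row (`ineq246`).  Companion files, nothing restated:
`BIJ88RandomWalk242` (p13: `Walk`, `Near`, `cubesMet`, `closure`, `region`, `cX`, `memX`, `ineq246_of_bound`) and
`BIJ88WalkGeometry246` (p36: walk-length geometry and the geometric tail over [6]'s tuples).
WHAT IS REPRODUCED, and how.  THE SETTING OF [6] as explicit hypotheses (no operator is constructed): walks on the
lattice of `M`-cubes = labels `ι` with adjacency `adj` of out-degree `≤ D` ([6]: `3^d`) and a label distance `d` (zero
diagonal, symmetric, triangle inequality, `≤ 1` across adjacent labels — [6]'s sup-norm in cube units); `r(e_k)`-cubes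
`κ` with `cubeOf : ι → κ`, a touching relation (reflexive, symmetric, of degree `≤ K`, containing the boundary-layer
neighbourhood `cadj` of reading R1) such that NON-touching cubes are `≥ s` label units apart (`s ≈ r(e_k)/M`); sites
`α` in blocks `inBlock x i` (at most `s₀` per site, site-to-label distance `ldist` with `ldist i x ≤ b₀` on the block and
`μ`-Lipschitz along `d`); the primed radius `ρ = ¼r(e_k)` with `s/8 ≤ (ρ − b₀)/μ`; walk kernels `C_ω(x₁,x₂)` majorized
by `A·βⁿ` and vanishing unless `ω` is a nearest-neighbour walk from a block of `x₁` to a block of `x₂` (END-POINT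
LOCALITY of [6]'s factors `h_{ω₀} … h_{ω_n}`), `Dβ ≤ e^{−δ}`.  PROVED: `eighth_le_len_of_not_near` (a non-primed contributing walk has length `≥ s/8`), `length_ge_of_region` (a
contributing walk of the class `X` has length `≥ (s/16K²)|X|`: far visited cubes cost `s` steps each),
`abs_tsum_walks_le` / `abs_tsum_walks_le_exp` (for ANY class `S` of walks whose contributing members have length `≥ L`:
`|Σ_{ω∈S} C_ω(x₁,x₂)| ≤ s₀A(Dβ)^{⌈L⌉}/(1 − Dβ) ≤ (s₀A/(1 − Dβ))e^{−δL}`), `abs_cX_le_exp` (the class `X`),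
`abs_cX_le_printed` (for `r(e_k)` LARGE, i.e. `s₀A/(1 − Dβ) ≤ e^{δs/32K²}`, and `r(e_k) ≤ Ms`:
`|C_X(x₁,x₂)| ≤ e^{−c·r(e_k)·|X|}` for ALL `X, x₁, x₂` with the explicit `c = δ/(32K²M)`), `ineq246` (the typed row).
The largeness hypothesis is where the printed constant absorbs the prefactor (p. 260: `r(e_k) = |log e_k⁻¹|^r → ∞`).
NOT here: the operators and the verification of these hypotheses for the actual `C^{(k)}_Λ(u)` of (2.40) (they are the
L²-bounds of [6] Lemma 2.1 and the lower bound (2.38)); (2.47).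
-/

namespace Literature.MathematicalPhysics.QuantumFieldTheory.BalabanImbrieJaffe1984to88.BIJ88Ineq246Walks

open Finset
open Literature.MathematicalPhysics.QuantumFieldTheory.Balaban1983to89.B4RandomWalk213
open BIJ88RandomWalk242 BIJ88WalkGeometry246

variable {ι κ α : Type*} [Fintype ι] [DecidableEq ι] [Fintype κ] [DecidableEq κ]

/-! ## §1 Geometry: a contributing walk of the class `X` is long -/

omit [Fintype ι] [Fintype κ] [DecidableEq κ] in
/-- **LEAVING THE PRIMED NEIGHBOURHOOD COSTS `s/8` STEPS.**  A nearest-neighbour walk from a block of `x₁` to a block of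
`x₂` which is NOT primed (some visited label farther than `ρ = ¼r(e_k)` from `x₁` or from `x₂`) has length `≥ s/8`,
given blocks of `ldist`-radius `b₀`, `ldist` `μ`-Lipschitz along the label distance `d` (one unit per step), and
`s/8 ≤ (ρ − b₀)/μ`. [cite: BalabanImbrieJaffe1988, (2.46) p.264] -/
theorem eighth_le_len_of_not_near (adj : ι → ι → Prop) (ldist : ι → α → ℝ) (ρ : ℝ) (inBlock : α → ι → Prop)
    (d : ι → ι → ℝ) (hd0 : ∀ i, d i i = 0) (hdsymm : ∀ i l, d i l = d l i)
    (htri : ∀ i j l, d i l ≤ d i j + d j l) (hadj : ∀ i l, adj i l → d i l ≤ 1)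
    {s : ℕ} {μ b₀ : ℝ} (hμ : 0 < μ) (hld : ∀ (i l : ι) (x : α), ldist l x ≤ ldist i x + μ * d i l)
    (hb : ∀ (x : α) (i : ι), inBlock x i → ldist i x ≤ b₀) (hρ : (s : ℝ) / 8 ≤ (ρ - b₀) / μ)
    (ω : Walk ι) (hω : ω.IsNN adj) {x₁ x₂ : α} (h1 : inBlock x₁ ω.start) (h2 : inBlock x₂ ω.last)
    (hnp : ¬ Near ldist ρ ω x₁ x₂) : (s : ℝ) / 8 ≤ ω.len := by
  obtain ⟨l, hl, hnot⟩ : ∃ l ∈ ω.pts, ¬ (ldist l x₁ ≤ ρ ∧ ldist l x₂ ≤ ρ) := by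
    by_contra h
    push Not at h
    exact hnp fun l hl => h l hl
  obtain ⟨t, ht, rfl⟩ := (mem_pts_iff ω.start ω.steps l).mp hl
  have key : ∀ {x : α} {i : ι}, ldist i x ≤ b₀ → d i (ptAt ω.start ω.steps t) ≤ ω.len →
      ρ < ldist (ptAt ω.start ω.steps t) x → (s : ℝ) / 8 ≤ ω.len := by
    intro x i hbi hdi hρx
    have hl1 := hld i (ptAt ω.start ω.steps t) x
    have hμd : μ * d i (ptAt ω.start ω.steps t) ≤ μ * ω.len := mul_le_mul_of_nonneg_left hdi hμ.le
    have h3 : (ρ - b₀) / μ ≤ ω.len := by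
      rw [div_le_iff₀ hμ]
      linarith
    exact hρ.trans h3
  by_cases hx1 : ldist (ptAt ω.start ω.steps t) x₁ ≤ ρ
  · have hx2 : ρ < ldist (ptAt ω.start ω.steps t) x₂ := not_le.mp fun h => hnot ⟨hx1, h⟩
    refine key (hb x₂ _ h2) ?_ hx2
    have hlast : ptAt ω.start ω.steps ω.len = ω.last := ptAt_length _ _
    rw [← hlast, hdsymm]
    exact (dist_ptAt_le d hd0 htri hadj hω ht le_rfl).trans (by exact_mod_cast Nat.sub_le _ _)
  · refine key (hb x₁ _ h1) ?_ (not_le.mp hx1)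
    have h0 := dist_ptAt_le d hd0 htri hadj hω (Nat.zero_le t) ht
    rw [ptAt_zero, Nat.sub_zero] at h0
    exact h0.trans (by exact_mod_cast ht)

omit [Fintype ι] in
/-- **WALKS OF THE CLASS `X` ARE LONG.**  Geometry of [6]'s walks on the lattice of `M`-cubes (labels `ι`, label distance
`d`: zero on the diagonal, symmetric, triangle inequality, `≤ 1` across adjacent labels), of the `r(e_k)`-cubes (`cubeOf`,
touching relation `touch`: reflexive, symmetric, of degree `≤ K`, containing the boundary-layer neighbourhood `cadj`;
non-touching cubes are `≥ s` label units apart, `s ≈ r(e_k)/M`), and of the primed condition (site-to-label distance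
`ldist` Lipschitz along labels with constant `μ ≈ M`, blocks of radius `b₀`, and `s/8 ≤ (ρ − b₀)/μ`, `ρ = ¼r(e_k)`):
a nearest-neighbour walk from a block of `x₁` to a block of `x₂` which is NOT primed has length
`≥ (s/(16K²))·|X(ω)|`. Mechanism: `|X| ≤ K|X⁰|`, a pairwise-far subfamily of `≥ |X⁰|/K` visited cubes costs `s` steps
per cube (`BIJ88WalkGeometry246.length_lower_bound`), and leaving the `ρ`-neighbourhood of `x₁` or `x₂` costs `≥ s/8`
steps. [cite: BalabanImbrieJaffe1988, (2.46) p.264] -/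
theorem length_ge_of_region (adj : ι → ι → Prop) [DecidableRel adj] (ldist : ι → α → ℝ) (ρ : ℝ)
    (cubeOf : ι → κ) (cadj : κ → κ → Prop) [DecidableRel cadj] (inBlock : α → ι → Prop)
    (d : ι → ι → ℝ) (hd0 : ∀ i, d i i = 0) (hdsymm : ∀ i l, d i l = d l i)
    (htri : ∀ i j l, d i l ≤ d i j + d j l) (hadj : ∀ i l, adj i l → d i l ≤ 1)
    (touch : κ → κ → Prop) [DecidableRel touch] (hrefl : ∀ c, touch c c)
    (htsymm : ∀ c c', touch c c' → touch c' c) {K : ℕ}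
    (hK : ∀ (c : κ) (Y : Finset κ), (Y.filter fun c' => touch c c').card ≤ K)
    (hKc : ∀ c : κ, (Finset.univ.filter fun c' => c = c' ∨ cadj c c').card ≤ K)
    {s : ℕ} (hfar : ∀ i l, ¬ touch (cubeOf i) (cubeOf l) → (s : ℝ) ≤ d i l)
    {μ b₀ : ℝ} (hμ : 0 < μ) (hld : ∀ (i l : ι) (x : α), ldist l x ≤ ldist i x + μ * d i l)
    (hb : ∀ (x : α) (i : ι), inBlock x i → ldist i x ≤ b₀) (hρ : (s : ℝ) / 8 ≤ (ρ - b₀) / μ)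
    (ω : Walk ι) (hω : ω.IsNN adj) {x₁ x₂ : α} (h1 : inBlock x₁ ω.start) (h2 : inBlock x₂ ω.last)
    (hnp : ¬ Near ldist ρ ω x₁ x₂) :
    (s : ℝ) / (16 * K * K) * (region cubeOf cadj ω).card ≤ ω.len := by
  classical
  -- (1) far cubes along the walk are ≥ s time units apart
  have hsep : ∀ t₁ t₂ : ℕ, t₁ ≤ t₂ → t₂ ≤ ω.len →
      ¬ touch (cubeOf (ptAt ω.start ω.steps t₁)) (cubeOf (ptAt ω.start ω.steps t₂)) → s ≤ t₂ - t₁ := by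
    intro t₁ t₂ h12 h2 hnt
    have h := (hfar _ _ hnt).trans (dist_ptAt_le d hd0 htri hadj hω h12 h2)
    exact_mod_cast h
  -- (2) the visited cubes X⁰ and the class X
  obtain ⟨q, hq, hqs⟩ := length_lower_bound cubeOf touch hrefl htsymm hK s hsep
  have hX0 : (cubesMet cubeOf ω).card ≤ K * q := hq
  have hX : (region cubeOf cadj ω).card ≤ K * (cubesMet cubeOf ω).card :=
    card_le_of_covered (fun c c' => c = c' ∨ cadj c c') hKc (cubesMet cubeOf ω) (region cubeOf cadj ω)
      fun c' hc' => by
        rcases mem_closure.mp hc' with h | ⟨c, hc, hcc⟩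
        · exact ⟨c', h, Or.inl rfl⟩
        · exact ⟨c, hc, Or.inr hcc⟩
  -- (3) not primed ⇒ at least s/8 steps
  have hnp' : (s : ℝ) / 8 ≤ ω.len :=
    eighth_le_len_of_not_near adj ldist ρ inBlock d hd0 hdsymm htri hadj hμ hld hb hρ ω hω h1 h2 hnp
  -- (4) arithmetic: two cases on |X| vs 2K²
  set m := (region cubeOf cadj ω).card with hm
  have hmq : m ≤ K * K * q := hX.trans (by rw [mul_assoc]; exact Nat.mul_le_mul_left K hX0)
  rcases Nat.eq_zero_or_pos K with hK0 | hKpos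
  · have hm0 : m = 0 := by rw [hK0] at hmq; simpa using hmq
    rw [hm0]
    simp
  · have hKr : (0 : ℝ) < K := by exact_mod_cast hKpos
    have hKK : (0 : ℝ) < 16 * K * K := by positivity
    by_cases hcase : m ≤ 2 * K * K
    · calc (s : ℝ) / (16 * K * K) * m ≤ (s : ℝ) / (16 * K * K) * (2 * K * K) :=
            mul_le_mul_of_nonneg_left (by exact_mod_cast hcase) (by positivity)
        _ = (s : ℝ) / 8 := by field_simp; ring
        _ ≤ ω.len := hnp'
    · have hlt : 2 * K * K < m := not_le.mp hcase
      have hq2 : 2 < q := by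
        have : K * K * 2 < K * K * q := by
          calc K * K * 2 = 2 * K * K := by ring
            _ < m := hlt
            _ ≤ K * K * q := hmq
        exact Nat.lt_of_mul_lt_mul_left this
      have hq1 : 1 ≤ q := by omega
      have hqs' : ((q : ℝ) - 1) * s ≤ ω.len := by
        have h := hqs
        have : (((q - 1) * s : ℕ) : ℝ) = ((q : ℝ) - 1) * s := by
          rw [Nat.cast_mul, Nat.cast_sub hq1, Nat.cast_one]
        rw [← this]
        exact_mod_cast h
      have hqr : (2 : ℝ) < q := by exact_mod_cast hq2
      have hmr : (m : ℝ) ≤ K * K * q := by exact_mod_cast hmq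
      have hs0 : (0 : ℝ) ≤ s := Nat.cast_nonneg s
      -- s/(16K²)·m ≤ s·m/(2K²) ≤ s·q/2 ≤ s·(q−1) ≤ len
      have hq0 : (0 : ℝ) ≤ q := Nat.cast_nonneg q
      have hsm : (s : ℝ) * m ≤ s * (K * K * q) := mul_le_mul_of_nonneg_left hmr hs0
      have step1 : (s : ℝ) / (16 * K * K) * m ≤ (s : ℝ) * q / 2 := by
        rw [div_mul_eq_mul_div, div_le_div_iff₀ hKK (by norm_num : (0:ℝ) < 2)]
        nlinarith [hsm, mul_nonneg (mul_nonneg hs0 hq0) (mul_self_nonneg (K : ℝ))]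
      have step2 : (s : ℝ) * q / 2 ≤ ((q : ℝ) - 1) * s := by
        nlinarith [mul_nonneg hs0 (sub_nonneg.mpr hqr.le)]
      linarith

/-! ## §2 The tail of the walk expansion over a class of walks -/

omit [Fintype κ] [DecidableEq κ] in
/-- **A CLASS OF LONG WALKS SUMS TO A GEOMETRIC TAIL.**  If the walk kernels `C_ω(x₁,x₂)` are majorized by `A·βⁿ` (`n` the
length), vanish unless `ω` is a nearest-neighbour walk from a block of `x₁` to a block of `x₂` (END-POINT LOCALITY of
[6]'s terms), every label has at most `D` neighbours, at most `s₀` blocks contain a site, `Dβ < 1`, and every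
CONTRIBUTING walk of a class `S` has length `≥ L`, then `|Σ_{ω ∈ S} C_ω(x₁,x₂)| ≤ s₀·A·(Dβ)^{⌈L⌉}/(1 − Dβ)`
(`BIJ88WalkGeometry246.abs_tsum_indicator_le` transported along `Walk.equivSigma`). [cite: BalabanImbrieJaffe1988, (2.46) p.264] -/
theorem abs_tsum_walks_le (adj : ι → ι → Prop) [DecidableRel adj] (Cw : Walk ι → α → α → ℝ)
    (inBlock : α → ι → Prop) {A β : ℝ} {D s₀ : ℕ} (hA : 0 ≤ A) (hβ0 : 0 ≤ β)
    (hD : ∀ j, (Finset.univ.filter fun i => adj j i).card ≤ D) (hθ : (D : ℝ) * β < 1)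
    (hmaj : ∀ ω x₁ x₂, |Cw ω x₁ x₂| ≤ A * β ^ ω.len)
    (hnz : ∀ ω x₁ x₂, Cw ω x₁ x₂ ≠ 0 → ω.IsNN adj ∧ inBlock x₁ ω.start ∧ inBlock x₂ ω.last)
    (hS₀ : ∀ x, ∃ S₀ : Finset ι, S₀.card ≤ s₀ ∧ ∀ i, inBlock x i → i ∈ S₀)
    (S : Set (Walk ι)) (x₁ x₂ : α) (L : ℝ) (hlen : ∀ ω ∈ S, Cw ω x₁ x₂ ≠ 0 → L ≤ ω.len) :
    |∑' ω, S.indicator (fun ω => Cw ω x₁ x₂) ω| ≤ s₀ * A * ((D : ℝ) * β) ^ ⌈L⌉₊ / (1 - D * β) := by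
  classical
  obtain ⟨S₀, hS₀c, hS₀m⟩ := hS₀ x₁
  have hθ0 : 0 ≤ (D : ℝ) * β := mul_nonneg (Nat.cast_nonneg D) hβ0
  set F : Walk ι → ℝ := fun ω => Cw ω x₁ x₂ with hF
  set S' : Set (Walk ι) := {ω | ω ∈ S ∧ Cw ω x₁ x₂ ≠ 0} with hS'def
  have hind : ∀ ω, S.indicator F ω = S'.indicator F ω := fun ω => by
    by_cases hz : Cw ω x₁ x₂ = 0
    · simp [Set.indicator_apply, hF, hz]
    · have hiff : ω ∈ S' ↔ ω ∈ S := by simp [hS'def, hz]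
      by_cases hω : ω ∈ S
      · rw [Set.indicator_of_mem hω, Set.indicator_of_mem (hiff.mpr hω)]
      · rw [Set.indicator_of_notMem hω, Set.indicator_of_notMem (fun h => hω (hiff.mp h))]
  let e : Tup ι ≃ Walk ι := Walk.equivSigma.symm
  have h1 : (∑' ω, S.indicator F ω) = ∑' p : Tup ι, (e ⁻¹' S').indicator (F ∘ e) p := by
    rw [show (fun ω => S.indicator F ω) = fun ω => S'.indicator F ω from funext hind]
    exact (Equiv.tsum_eq e fun ω => S'.indicator F ω).symm.trans
      (tsum_congr fun p => (Set.indicator_comp_right e).symm)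
  rw [h1]
  have hb := abs_tsum_indicator_le adj S₀ (N := ⌈L⌉₊) hA hβ0 hD hθ (F ∘ e) (e ⁻¹' S')
    (fun p => by
      show |Cw (e p) x₁ x₂| ≤ _
      by_cases hz : Cw (e p) x₁ x₂ = 0
      · rw [hz, abs_zero]
        split_ifs
        · exact mul_nonneg hA (pow_nonneg hβ0 _)
        · exact le_rfl
      · obtain ⟨hnn, hin, -⟩ := hnz (e p) x₁ x₂ hz
        rw [if_pos ⟨hnn, hS₀m _ hin⟩]
        exact hmaj (e p) x₁ x₂)
    (fun p hp => Nat.ceil_le.mpr (hlen (e p) hp.1 hp.2))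
  refine hb.trans (div_le_div_of_nonneg_right ?_ (by linarith))
  exact mul_le_mul_of_nonneg_right (mul_le_mul_of_nonneg_right (by exact_mod_cast hS₀c) hA) (pow_nonneg hθ0 _)

omit [Fintype κ] [DecidableEq κ] in
/-- **EXPONENTIAL FORM** of `abs_tsum_walks_le`: under `Dβ ≤ e^{−δ}`, `δ > 0`,
`|Σ_{ω ∈ S} C_ω(x₁,x₂)| ≤ (s₀A/(1 − Dβ))·e^{−δL}`. [cite: BalabanImbrieJaffe1988, (2.46) p.264] -/
theorem abs_tsum_walks_le_exp (adj : ι → ι → Prop) [DecidableRel adj] (Cw : Walk ι → α → α → ℝ)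
    (inBlock : α → ι → Prop) {A β δ : ℝ} {D s₀ : ℕ} (hA : 0 ≤ A) (hβ0 : 0 ≤ β)
    (hD : ∀ j, (Finset.univ.filter fun i => adj j i).card ≤ D) (hδ : 0 < δ) (hθ : (D : ℝ) * β ≤ Real.exp (-δ))
    (hmaj : ∀ ω x₁ x₂, |Cw ω x₁ x₂| ≤ A * β ^ ω.len)
    (hnz : ∀ ω x₁ x₂, Cw ω x₁ x₂ ≠ 0 → ω.IsNN adj ∧ inBlock x₁ ω.start ∧ inBlock x₂ ω.last)
    (hS₀ : ∀ x, ∃ S₀ : Finset ι, S₀.card ≤ s₀ ∧ ∀ i, inBlock x i → i ∈ S₀)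
    (S : Set (Walk ι)) (x₁ x₂ : α) (L : ℝ) (hlen : ∀ ω ∈ S, Cw ω x₁ x₂ ≠ 0 → L ≤ ω.len) :
    |∑' ω, S.indicator (fun ω => Cw ω x₁ x₂) ω| ≤ s₀ * A / (1 - D * β) * Real.exp (-(δ * L)) := by
  have he1 : Real.exp (-δ) < 1 := Real.exp_lt_one_iff.mpr (neg_lt_zero.mpr hδ)
  have hθ1 : (D : ℝ) * β < 1 := hθ.trans_lt he1
  have hθ0 : 0 ≤ (D : ℝ) * β := mul_nonneg (Nat.cast_nonneg D) hβ0
  have h := abs_tsum_walks_le adj Cw inBlock hA hβ0 hD hθ1 hmaj hnz hS₀ S x₁ x₂ L hlen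
  have hpow : ((D : ℝ) * β) ^ ⌈L⌉₊ ≤ Real.exp (-(δ * L)) := by
    calc ((D : ℝ) * β) ^ ⌈L⌉₊ ≤ Real.exp (-δ) ^ ⌈L⌉₊ := pow_le_pow_left₀ hθ0 hθ _
      _ = Real.exp (-(δ * ⌈L⌉₊)) := by rw [← Real.exp_nat_mul]; ring_nf
      _ ≤ Real.exp (-(δ * L)) := by
          rw [Real.exp_le_exp, neg_le_neg_iff]
          exact mul_le_mul_of_nonneg_left (Nat.le_ceil _) hδ.le
  have hK : 0 ≤ s₀ * A / (1 - (D : ℝ) * β) := div_nonneg (mul_nonneg (Nat.cast_nonneg _) hA) (by linarith)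
  calc |∑' ω, S.indicator (fun ω => Cw ω x₁ x₂) ω| ≤ s₀ * A * ((D : ℝ) * β) ^ ⌈L⌉₊ / (1 - D * β) := h
    _ = s₀ * A / (1 - D * β) * ((D : ℝ) * β) ^ ⌈L⌉₊ := by ring
    _ ≤ s₀ * A / (1 - D * β) * Real.exp (-(δ * L)) := mul_le_mul_of_nonneg_left hpow hK

/-- **THE CLASS-`X` SUM**: `|C^{(k)}_{Λ,X}(x₁,x₂)| ≤ (s₀A/(1 − Dβ))·e^{−δL(X)}` whenever every contributing walk of the
class `X` (non-primed, region `X`) has length `≥ L(X)` (`abs_tsum_walks_le_exp` for `S = {¬Σ′, X(ω) = X}`).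
[cite: BalabanImbrieJaffe1988, (2.46) p.264] -/
theorem abs_cX_le_exp (adj : ι → ι → Prop) [DecidableRel adj] (ldist : ι → α → ℝ) (ρ : ℝ) (cubeOf : ι → κ)
    (cadj : κ → κ → Prop) (Cw : Walk ι → α → α → ℝ) (inBlock : α → ι → Prop) {A β δ : ℝ} {D s₀ : ℕ}
    (L : Finset κ → ℝ) (hA : 0 ≤ A) (hβ0 : 0 ≤ β)
    (hD : ∀ j, (Finset.univ.filter fun i => adj j i).card ≤ D) (hδ : 0 < δ) (hθ : (D : ℝ) * β ≤ Real.exp (-δ))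
    (hmaj : ∀ ω x₁ x₂, |Cw ω x₁ x₂| ≤ A * β ^ ω.len)
    (hnz : ∀ ω x₁ x₂, Cw ω x₁ x₂ ≠ 0 → ω.IsNN adj ∧ inBlock x₁ ω.start ∧ inBlock x₂ ω.last)
    (hS₀ : ∀ x, ∃ S₀ : Finset ι, S₀.card ≤ s₀ ∧ ∀ i, inBlock x i → i ∈ S₀)
    (hlen : ∀ ω X x₁ x₂, Cw ω x₁ x₂ ≠ 0 → ¬ Near ldist ρ ω x₁ x₂ → region cubeOf cadj ω = X → L X ≤ ω.len)
    (X : Finset κ) (x₁ x₂ : α) :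
    |cX ldist ρ cubeOf cadj Cw X x₁ x₂| ≤ s₀ * A / (1 - D * β) * Real.exp (-(δ * L X)) :=
  abs_tsum_walks_le_exp adj Cw inBlock hA hβ0 hD hδ hθ hmaj hnz hS₀
    {ω | ¬ Near ldist ρ ω x₁ x₂ ∧ region cubeOf cadj ω = X} x₁ x₂ (L X)
    fun ω hω hz => hlen ω X x₁ x₂ hz hω.1 hω.2

omit [Fintype ι] in
/-- no walk has an empty class: `C^{(k)}_{Λ,∅} = 0` (the class of a walk contains the cube of its starting label).
[cite: BalabanImbrieJaffe1988, (2.46) p.264] -/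
theorem cX_empty (ldist : ι → α → ℝ) (ρ : ℝ) (cubeOf : ι → κ) (cadj : κ → κ → Prop)
    (Cw : Walk ι → α → α → ℝ) (x₁ x₂ : α) : cX ldist ρ cubeOf cadj Cw ∅ x₁ x₂ = 0 := by
  unfold cX
  rw [← tsum_zero (β := Walk ι)]
  refine tsum_congr fun ω => Set.indicator_of_notMem (fun hω => ?_) _
  have h : cubeOf ω.start ∈ region cubeOf cadj ω :=
    subset_closure cadj _ (Finset.mem_image_of_mem cubeOf ω.start_mem_pts)
  rw [hω.2] at h
  exact Finset.notMem_empty _ h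

/-! ## §3 The printed bound (2.46) in [6]'s setting, and the typed row `Ineq246` -/

/-- **(2.46) PROVED IN THE SETTING OF [6]** («model instance»).  Walks on the lattice of `M`-cubes with the label
geometry of `length_ge_of_region` (`s` label units between non-touching `r(e_k)`-cubes, `s/8 ≤ (ρ − b₀)/μ`), walk kernels
majorized by `A·βⁿ` with END-POINT LOCALITY, out-degree `≤ D`, `Dβ ≤ e^{−δ}`, at most `s₀` blocks per site, and `r(e_k)`
LARGE in the sense `s₀A/(1 − Dβ) ≤ exp(δs/(32K²))`, `r(e_k) ≤ M·s`: then for ALL `X, x₁, x₂`,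
`|C^{(k)}_{Λ,X}(u; x₁, x₂)| ≤ e^{−c·r(e_k)·|X|}` with the explicit `c = δ/(32K²M)` — the printed
*"|C^{(k)}_{Λ,X}(u; x₁, x₂)| ≦ e^{−cr(e_k)|X|} (2.46)"*, `|X|` the number of `r(e_k)`-cubes of `X`.
[cite: BalabanImbrieJaffe1988, (2.46) p.264] -/
theorem abs_cX_le_printed (adj : ι → ι → Prop) [DecidableRel adj] (ldist : ι → α → ℝ) (ρ : ℝ)
    (cubeOf : ι → κ) (cadj : κ → κ → Prop) [DecidableRel cadj] (Cw : Walk ι → α → α → ℝ)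
    (inBlock : α → ι → Prop) (d : ι → ι → ℝ) (hd0 : ∀ i, d i i = 0) (hdsymm : ∀ i l, d i l = d l i)
    (htri : ∀ i j l, d i l ≤ d i j + d j l) (hadj : ∀ i l, adj i l → d i l ≤ 1)
    (touch : κ → κ → Prop) [DecidableRel touch] (hrefl : ∀ c, touch c c)
    (htsymm : ∀ c c', touch c c' → touch c' c) {K : ℕ}
    (hK : ∀ (c : κ) (Y : Finset κ), (Y.filter fun c' => touch c c').card ≤ K)
    (hKc : ∀ c : κ, (Finset.univ.filter fun c' => c = c' ∨ cadj c c').card ≤ K)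
    {s : ℕ} (hfar : ∀ i l, ¬ touch (cubeOf i) (cubeOf l) → (s : ℝ) ≤ d i l)
    {μ b₀ : ℝ} (hμ : 0 < μ) (hld : ∀ (i l : ι) (x : α), ldist l x ≤ ldist i x + μ * d i l)
    (hb : ∀ (x : α) (i : ι), inBlock x i → ldist i x ≤ b₀) (hρ : (s : ℝ) / 8 ≤ (ρ - b₀) / μ)
    {A β δ : ℝ} {D s₀ : ℕ} (hA : 0 ≤ A) (hβ0 : 0 ≤ β)
    (hD : ∀ j, (Finset.univ.filter fun i => adj j i).card ≤ D) (hδ : 0 < δ) (hθ : (D : ℝ) * β ≤ Real.exp (-δ))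
    (hmaj : ∀ ω x₁ x₂, |Cw ω x₁ x₂| ≤ A * β ^ ω.len)
    (hnz : ∀ ω x₁ x₂, Cw ω x₁ x₂ ≠ 0 → ω.IsNN adj ∧ inBlock x₁ ω.start ∧ inBlock x₂ ω.last)
    (hS₀ : ∀ x, ∃ S₀ : Finset ι, S₀.card ≤ s₀ ∧ ∀ i, inBlock x i → i ∈ S₀)
    {M rek : ℝ} (hM : 0 < M) (hs : rek ≤ M * s)
    (hlarge : s₀ * A / (1 - D * β) ≤ Real.exp (δ * s / (32 * K * K))) (X : Finset κ) (x₁ x₂ : α) :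
    |cX ldist ρ cubeOf cadj Cw X x₁ x₂| ≤ Real.exp (-(δ / (32 * K * K * M)) * rek * (X.card : ℕ)) := by
  rcases X.eq_empty_or_nonempty with rfl | hne
  · rw [cX_empty, abs_zero]
    exact (Real.exp_pos _).le
  · -- the geometric length bound L X = (s/(16K²))·|X|
    have hlen : ∀ ω (Y : Finset κ) y₁ y₂, Cw ω y₁ y₂ ≠ 0 → ¬ Near ldist ρ ω y₁ y₂ → region cubeOf cadj ω = Y →
        (s : ℝ) / (16 * K * K) * Y.card ≤ ω.len := by
      intro ω Y y₁ y₂ hz hnp hY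
      obtain ⟨hnn, h1, h2⟩ := hnz ω y₁ y₂ hz
      rw [← hY]
      exact length_ge_of_region adj ldist ρ cubeOf cadj inBlock d hd0 hdsymm htri hadj touch hrefl htsymm hK hKc
        hfar hμ hld hb hρ ω hnn h1 h2 hnp
    have h := abs_cX_le_exp adj ldist ρ cubeOf cadj Cw inBlock (fun Y => (s : ℝ) / (16 * K * K) * Y.card) hA
      hβ0 hD hδ hθ hmaj hnz hS₀ hlen X x₁ x₂
    -- absorb the prefactor: |X| ≥ 1 and s₀A/(1−Dβ) ≤ e^{c″}, c″ = δs/(32K²); c·rek ≤ c″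
    have hcard : (1 : ℝ) ≤ X.card := by exact_mod_cast Finset.card_pos.mpr hne
    set c'' : ℝ := δ * s / (32 * K * K) with hc''
    have hc''0 : 0 ≤ c'' := by positivity
    have hexp : δ * ((s : ℝ) / (16 * K * K) * X.card) = 2 * c'' * X.card := by rw [hc'']; ring
    have hcrek : δ / (32 * K * K * M) * rek ≤ c'' := by
      rw [hc'']
      rcases Nat.eq_zero_or_pos K with hK0 | hKpos
      · simp [hK0]
      · have hKK : (0 : ℝ) < 32 * K * K := by positivity
        rw [div_mul_eq_mul_div, div_le_div_iff₀ (by positivity) hKK]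
        have : δ * rek ≤ δ * (M * s) := mul_le_mul_of_nonneg_left hs hδ.le
        nlinarith [this, hKK, hM]
    calc |cX ldist ρ cubeOf cadj Cw X x₁ x₂|
        ≤ s₀ * A / (1 - D * β) * Real.exp (-(δ * ((s : ℝ) / (16 * K * K) * X.card))) := h
      _ ≤ Real.exp c'' * Real.exp (-(2 * c'' * X.card)) := by
          rw [hexp]
          exact mul_le_mul_of_nonneg_right hlarge (Real.exp_pos _).le
      _ = Real.exp (c'' - 2 * c'' * X.card) := by rw [← Real.exp_add]; ring_nf
      _ ≤ Real.exp (-(δ / (32 * K * K * M)) * rek * (X.card : ℕ)) := by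
          rw [Real.exp_le_exp]
          have h3 : δ / (32 * K * K * M) * rek * X.card ≤ c'' * X.card :=
            mul_le_mul_of_nonneg_right hcrek (by positivity)
          nlinarith [h3, hcard, hc''0]

/-- **THE TYPED ROW (2.46)** `BIJ88Sect2Statements.Ineq246` for the `C^{(k)}_{Λ,X}` of `BIJ88RandomWalk242.cX` in [6]'s
setting: support clause (p13's `cX_support`, from end-point locality) AND the bound, with `|X| = X.card`,
`mem = BIJ88RandomWalk242.memX` and the explicit rate `c = δ/(32K²M)` — assembled by p13's `ineq246_of_bound`, whose
bound hypothesis is DISCHARGED by `abs_cX_le_printed`. [cite: BalabanImbrieJaffe1988, (2.46) p.264] -/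
theorem ineq246 (adj : ι → ι → Prop) [DecidableRel adj] (ldist : ι → α → ℝ) (ρ : ℝ)
    (cubeOf : ι → κ) (cadj : κ → κ → Prop) [DecidableRel cadj] (Cw : Walk ι → α → α → ℝ)
    (inBlock : α → ι → Prop) (d : ι → ι → ℝ) (hd0 : ∀ i, d i i = 0) (hdsymm : ∀ i l, d i l = d l i)
    (htri : ∀ i j l, d i l ≤ d i j + d j l) (hadj : ∀ i l, adj i l → d i l ≤ 1)
    (touch : κ → κ → Prop) [DecidableRel touch] (hrefl : ∀ c, touch c c)
    (htsymm : ∀ c c', touch c c' → touch c' c) {K : ℕ}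
    (hK : ∀ (c : κ) (Y : Finset κ), (Y.filter fun c' => touch c c').card ≤ K)
    (hKc : ∀ c : κ, (Finset.univ.filter fun c' => c = c' ∨ cadj c c').card ≤ K)
    {s : ℕ} (hfar : ∀ i l, ¬ touch (cubeOf i) (cubeOf l) → (s : ℝ) ≤ d i l)
    {μ b₀ : ℝ} (hμ : 0 < μ) (hld : ∀ (i l : ι) (x : α), ldist l x ≤ ldist i x + μ * d i l)
    (hb : ∀ (x : α) (i : ι), inBlock x i → ldist i x ≤ b₀) (hρ : (s : ℝ) / 8 ≤ (ρ - b₀) / μ)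
    {A β δ : ℝ} {D s₀ : ℕ} (hA : 0 ≤ A) (hβ0 : 0 ≤ β)
    (hD : ∀ j, (Finset.univ.filter fun i => adj j i).card ≤ D) (hδ : 0 < δ) (hθ : (D : ℝ) * β ≤ Real.exp (-δ))
    (hmaj : ∀ ω x₁ x₂, |Cw ω x₁ x₂| ≤ A * β ^ ω.len)
    (hnz : ∀ ω x₁ x₂, Cw ω x₁ x₂ ≠ 0 → ω.IsNN adj ∧ inBlock x₁ ω.start ∧ inBlock x₂ ω.last)
    (hS₀ : ∀ x, ∃ S₀ : Finset ι, S₀.card ≤ s₀ ∧ ∀ i, inBlock x i → i ∈ S₀)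
    {M rek : ℝ} (hM : 0 < M) (hs : rek ≤ M * s)
    (hlarge : s₀ * A / (1 - D * β) ≤ Real.exp (δ * s / (32 * K * K))) :
    BIJ88Sect2Statements.Ineq246 (fun X : Finset κ => X.card) (memX inBlock cubeOf cadj)
      (cX ldist ρ cubeOf cadj Cw) (δ / (32 * K * K * M)) rek :=
  ineq246_of_bound ldist ρ cubeOf cadj inBlock (fun ω x₁ x₂ h => (hnz ω x₁ x₂ h).2) _ rek
    fun X x₁ x₂ => abs_cX_le_printed adj ldist ρ cubeOf cadj Cw inBlock d hd0 hdsymm htri hadj touch hrefl htsymm hK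
      hKc hfar hμ hld hb hρ hA hβ0 hD hδ hθ hmaj hnz hS₀ hM hs hlarge X x₁ x₂

end Literature.MathematicalPhysics.QuantumFieldTheory.BalabanImbrieJaffe1984to88.BIJ88Ineq246Walks
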